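import Summits.CriticalPhenomena.CardyFormulaZ2.Theorems.CardyComplexConeEdgePrecompactUFRSJunctionFunnelMainAlt

/-!
# The junction funnel: every crossing strand at a Dobrushin junction passes through the gate corner
(line `qkz-strip-boundary-arm` of crux `CardyComplexCone.EdgePrecompact`, stmt-CriticalPhenomena-11387;
the registered sub-goal S2 = `ufrs_junctionFunnel` of the per-scale junction bound HJ-S
`ufrs_junction_scale_le` and of the two-strand decay HJ `ufrs_rect_junctionTwoStrandDecay`,
lead c5, wave 4; last of the files `…UFRSJunctionFunnel*.lean`)

**Theorem** (`ufrs_junctionFunnel`, registered). Let `E` be `ℤ²`-admissible Dobrushin data of an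
open axis-parallel rectangle, `w` a lattice vector with `‖δw‖ < η`, `e₀` a marked (`A`–`B`) edge
of `E` or of its translate `shiftData E w` with midpoint `m`, and `16 ≤ K`, `Kη ≤ r`, `64δ ≤ r`,
`2N₀δ ≤ r`, `16Kr ≤` the sides; assume every marked edge of `E` and of `shiftData E w` has its
midpoint within `r/K` of `m` or beyond `Kr` (one of them beyond), and every corner of the
rectangle is within `r/K` of `m` or beyond `Kr`. Then there are an automorphism `φ` of `ℤ²`, a
shape `corner` and gate parameters `N ≥ N₀`, `h ≤ N` such that no configuration of the junction
gate `ufrsJunctionGate φ corner N h` (`…UFRSJunctionGate.lean`: an open path and a closed dual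
path meeting at a corner `c₀`, placed by `φ`) carries two corner-disjoint strand-crossings of the
annulus `A(m; r, Kr)` (`ufrsStrands E w m 2 r (Kr)`).

**Proof.** `junction_mainAlt_JF` (`…UFRSJunctionFunnelMainAlt.lean`) applied to the datum carrying
`e₀` and the translation `±w`: on the gate ONE physical corner is visited by every orbit stretch
of the completed configuration of either datum, through the respective inner faces, joining the
`r`-ball about `m` to distance `≥ Kr` — the discrete Jordan-curve argument of
`…UFRSJunctionFunnelCore.lean` (the fence = open path ∪ link ∪ dual path ∪ legs of the gate,
which exploration interfaces cross only at the link, through `c₀`), transported along a rotation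
frame (`…Frame.lean`, `…Ref.lean`), with the gate read in the frame for either chirality
(`…GateRead.lean`) and the boundary colours near the junction (`…Colours.lean`). Two
corner-disjoint crossing stretches (`ufrsStrands … 2 …`) would both contain it.

References: H. Kesten, Comm. Math. Phys. 109 (1987), §2; S. Smirnov, C. R. Acad. Sci. Paris 333
(2001), §2; G. Grimmett, *Percolation* (1999), §11.2.
-/

set_option linter.unusedVariables false

namespace Summit.CriticalPhenomena.CardyFormulaZ2.Cruxes.EdgePrecompact.QkzStripBoundaryArm

open MeasureTheory Filter Set Metric
open scoped Topology BigOperators Pointwise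
open Literature.Probability.LatticeModels Literature.Probability.Percolation
open Literature.Probability.RandomPlanarGeometry (DobrushinDomain)
open Summit.CriticalPhenomena.CardyFormulaZ2.Theses.CardyComplexCone

noncomputable section

/-! ## The registered statement -/

/-- **The junction funnel** (registered sub-goal S2 = `ufrs_junctionFunnel` of the per-scale
junction bound HJ-S of stmt-CriticalPhenomena-11387). At a Dobrushin junction `m` (a marked edge
`e₀` of `E` or of its translate `shiftData E w`) of an axis-parallel rectangle, in a window of
scales free of other marked points and of corners of the rectangle except very near `m`, there is
an orientation `φ`, a shape `corner` and gate parameters `N ≥ N₀`, `h ≤ N` such that on the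
junction gate `ufrsJunctionGate φ corner N h` the configuration carries NO two corner-disjoint
strand-crossings of the annulus `A(m; r, Kr)` (`ufrsStrands E w m 2 r (Kr)`): by
`junction_mainAlt_JF` every crossing orbit stretch of the completed configuration of either datum
passes through one and the same corner of the gate. -/
theorem ufrs_junctionFunnel : ∀ (N₀ : ℕ) (E : DiscreteDobrushin) (x₀ x₁ y₀ y₁ : ℝ), x₀ < x₁ → y₀ < y₁ → E.Ω = Set.Ioo x₀ x₁ ×ℂ Set.Ioo y₀ y₁ → E.IsZdAdmissible → ∀ (w : Site 2) (η : ℝ), ‖meshPoint E.δ w‖ < η → ∀ e₀ : Sym2 (Site 2), (e₀ ∈ E.zdABEdges ∨ e₀ ∈ (shiftData E w).zdABEdges) → ∀ (r K : ℝ), 16 ≤ K → K * η ≤ r → 64 * E.δ ≤ r → 2 * (N₀ : ℝ) * E.δ ≤ r → 16 * (K * r) ≤ min (x₁ - x₀) (y₁ - y₀) → (∀ e : Sym2 (Site 2), (e ∈ E.zdABEdges ∨ e ∈ (shiftData E w).zdABEdges) → dist (medialPoint E.δ e) (medialPoint E.δ e₀) ≤ r / K ∨ K * r ≤ dist (medialPoint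 E.δ e) (medialPoint E.δ e₀)) → (∃ e : Sym2 (Site 2), (e ∈ E.zdABEdges ∨ e ∈ (shiftData E w).zdABEdges) ∧ K * r ≤ dist (medialPoint E.δ e) (medialPoint E.δ e₀)) → (∀ q : ℂ, (q.re = x₀ ∨ q.re = x₁) → (q.im = y₀ ∨ q.im = y₁) → dist q (medialPoint E.δ e₀) ≤ r / K ∨ K * r ≤ dist q (medialPoint E.δ e₀)) → ∃ (φ : zdGraph 2 ≃g zdGraph 2) (corner : Bool) (N h : ℕ), N₀ ≤ N ∧ h ≤ N ∧ ∀ ω : BondConfig (Site 2), ω ∈ ufrsJunctionGate φ corner N h → ω ∉ ufrsStrands E w (medialPoint E.δ e₀) 2 r (K * r) := by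
  intro N₀ E x₀ x₁ y₀ y₁ hx hy hEΩ hE w η hw e₀ he₀ r K hK hKη h64 hN₀ h16 hwin hfar hcorn
  have hη0 : 0 ≤ η := (norm_nonneg _).trans hw.le
  -- the conclusion from the main lemma applied to the datum `G` carrying `e₀` and its translate
  have finish : ∀ (G : DiscreteDobrushin) (u : Site 2), G.δ = E.δ →
      ((G = E ∧ shiftData G u = shiftData E w) ∨ (G = shiftData E w ∧ shiftData G u = E)) →
      (∃ (φ : zdGraph 2 ≃g zdGraph 2) (corner : Bool) (N h : ℕ), h ≤ N ∧ N₀ ≤ N ∧ ∀ ω : BondConfig (Site 2),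
        ω ∈ ufrsJunctionGate φ corner N h → ∃ c₀ : Site 2 × Fin 4, ∀ F : DiscreteDobrushin, (F = G ∨ F = shiftData G u) →
        ∀ (c : Site 2 × Fin 4) (i j' : ℕ), i ≤ j' → (∀ t, i ≤ t → t ≤ j' → F.IsInnerFace (cFace (cornerOrbit (F.bcBondConfig ω) c t))) →
        ((dist (meshPoint G.δ (cornerOrbit (F.bcBondConfig ω) c i).1) (medialPoint G.δ e₀) ≤ r ∧
            K * r ≤ dist (meshPoint G.δ (cornerOrbit (F.bcBondConfig ω) c j').1) (medialPoint G.δ e₀)) ∨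
          (K * r ≤ dist (meshPoint G.δ (cornerOrbit (F.bcBondConfig ω) c i).1) (medialPoint G.δ e₀) ∧
            dist (meshPoint G.δ (cornerOrbit (F.bcBondConfig ω) c j').1) (medialPoint G.δ e₀) ≤ r)) →
        ∃ s, i ≤ s ∧ s ≤ j' ∧ cornerOrbit (F.bcBondConfig ω) c s = c₀) →
      ∃ (φ : zdGraph 2 ≃g zdGraph 2) (corner : Bool) (N h : ℕ), N₀ ≤ N ∧ h ≤ N ∧ ∀ ω : BondConfig (Site 2),
        ω ∈ ufrsJunctionGate φ corner N h → ω ∉ ufrsStrands E w (medialPoint E.δ e₀) 2 r (K * r) := by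
    rintro G u hGδ hcase ⟨φ, corner, N, h, hhN, hN₀N, H⟩
    refine ⟨φ, corner, N, h, hN₀N, hhN, fun ω hω hstr => ?_⟩
    obtain ⟨c₀, hc₀⟩ := H ω hω
    rw [mem_ufrsStrands_iff] at hstr
    obtain ⟨c, i, j, τ, hstr, hdisj⟩ := hstr
    rw [hGδ] at hc₀
    have hsa : ∀ a : Fin 2, ∃ s, i a ≤ s ∧ s ≤ j a ∧
        cornerOrbit (if τ a then E.bcBondConfig ω else (shiftData E w).bcBondConfig ω) (c a) s = c₀ := by
      intro a
      obtain ⟨hij, hends, hfaces, -⟩ := hstr a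
      cases hτ : τ a
      · simp only [hτ, Bool.false_eq_true, ↓reduceIte] at hends hfaces ⊢
        rcases hcase with ⟨hGE, hG'⟩ | ⟨hGE, hG'⟩
        · exact hc₀ (shiftData E w) (Or.inr hG'.symm) (c a) (i a) (j a) hij hfaces hends
        · exact hc₀ (shiftData E w) (Or.inl hGE.symm) (c a) (i a) (j a) hij hfaces hends
      · simp only [hτ, ↓reduceIte] at hends hfaces ⊢
        rcases hcase with ⟨hGE, hG'⟩ | ⟨hGE, hG'⟩
        · exact hc₀ E (Or.inl hGE.symm) (c a) (i a) (j a) hij hfaces hends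
        · exact hc₀ E (Or.inr hG'.symm) (c a) (i a) (j a) hij hfaces hends
    obtain ⟨s₀, h₀i, h₀j, h₀⟩ := hsa 0
    obtain ⟨s₁, h₁i, h₁j, h₁⟩ := hsa 1
    exact hdisj 0 1 (by decide) s₀ s₁ h₀i h₀j h₁i h₁j (h₀.trans h₁.symm)
  rcases he₀ with he₀ | he₀
  · -- the junction is a marked edge of `E`
    refine finish E w rfl (Or.inl ⟨rfl, rfl⟩) ?_
    exact junction_mainAlt_JF N₀ E x₀ x₁ y₀ y₁ hE hEΩ w η hw e₀ he₀ r K hK hKη h64 hN₀ h16 hwin hfar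
      (fun q hq1 hq2 => (hcorn q hq1 hq2).imp (fun h' => by linarith) (fun h' => by linarith))
  · -- the junction is a marked edge of the translate: apply the main lemma to it and `-w`
    have hE' := isZdAdmissible_shiftData E w hE
    have hEΩ' : (shiftData E w).Ω = Set.Ioo ((meshPoint E.δ w).re + x₀) ((meshPoint E.δ w).re + x₁) ×ℂ
        Set.Ioo ((meshPoint E.δ w).im + y₀) ((meshPoint E.δ w).im + y₁) := by
      rw [shiftData_Ω, hEΩ, vadd_rect_ONE]
    have hback : shiftData (shiftData E w) (-w) = E := shiftData_neg_shiftData E w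
    refine finish (shiftData E w) (-w) rfl (Or.inr ⟨rfl, hback⟩) ?_
    refine junction_mainAlt_JF N₀ (shiftData E w) _ _ _ _ hE' hEΩ' (-w) η ?_ e₀ he₀ r K hK hKη h64 hN₀ ?_ ?_ ?_ ?_
    · rw [shiftData_δ, meshPoint_neg, norm_neg]; exact hw
    · have e1 : (meshPoint E.δ w).re + x₁ - ((meshPoint E.δ w).re + x₀) = x₁ - x₀ := by ring
      have e2 : (meshPoint E.δ w).im + y₁ - ((meshPoint E.δ w).im + y₀) = y₁ - y₀ := by ring
      rw [e1, e2]; exact h16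
    · intro e he
      rw [hback] at he
      exact hwin e he.symm
    · obtain ⟨e, he, hfar'⟩ := hfar
      exact ⟨e, by rw [hback]; exact he.symm, hfar'⟩
    · intro q hq1 hq2
      have hq : ((q - meshPoint E.δ w).re = x₀ ∨ (q - meshPoint E.δ w).re = x₁) ∧
          ((q - meshPoint E.δ w).im = y₀ ∨ (q - meshPoint E.δ w).im = y₁) := by
        simp only [Complex.sub_re, Complex.sub_im]
        constructor
        · rcases hq1 with h' | h' <;> [left; right] <;> linarith
        · rcases hq2 with h' | h' <;> [left; right] <;> linarith
      have hd : dist q (medialPoint E.δ e₀) ≤ dist (q - meshPoint E.δ w) (medialPoint E.δ e₀) + ‖meshPoint E.δ w‖ ∧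
          dist (q - meshPoint E.δ w) (medialPoint E.δ e₀) ≤ dist q (medialPoint E.δ e₀) + ‖meshPoint E.δ w‖ := by
        rw [dist_eq_norm, dist_eq_norm, show q - meshPoint E.δ w - medialPoint E.δ e₀ =
          (q - medialPoint E.δ e₀) - meshPoint E.δ w by ring]
        exact ⟨by have := norm_sub_norm_le (q - medialPoint E.δ e₀) (meshPoint E.δ w); linarith, norm_sub_le _ _⟩
      rcases hcorn _ hq.1 hq.2 with h' | h'
      · left; change dist q (medialPoint E.δ e₀) ≤ r / K + η; linarith [hd.1]
      · right; change K * r - η ≤ dist q (medialPoint E.δ e₀); linarith [hd.2]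

end

end Summit.CriticalPhenomena.CardyFormulaZ2.Cruxes.EdgePrecompact.QkzStripBoundaryArm
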